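import Mathlib
import Literature.Computability.AlgebraicComplexity.Apolarity
import Literature.Computability.AlgebraicComplexity.ApolarityAction
import Summits.ValiantsHypothesis.ValiantsHypothesis.Theorems.BorderApolarityFixedWitnessObstructionQPKuratowskiSubmodule
import Summits.ValiantsHypothesis.ValiantsHypothesis.Theorems.BorderApolarityToricFixedPointsToricLimitIsInitialAux1

/-!
# Border apolarity, crux `ToricFixedPoints` — the Kuratowski limit along a toric curve is the translated lowest-weight initial span

Route `ValiantsHypothesis/BorderApolarity`, crux item `stmt-ValiantsHypothesis-5779`, line
`bb-cell-state-polytope`, stub `stub_toricLimitIsInitial` (S1 of the lead's skeleton): along the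
toric curve `P_t = u · diag((t+2)^w) · f` the degree-wise Kuratowski limit of the annihilators
`Ann_k(P_t)` EXISTS and equals `{D : uᵀ D ∈ in_w(Ann_k f)}`, where `in_w(A)` is the span of the
lowest-`w`-weight initial forms of the elements of `A`.

Proof.  Transport of annihilators (`apolarAction_linSubst_eq_zero_iff`, `linSubst_mul`,
`diag = diagᵀ`): `D ∈ Ann_k(P_t) ↔ diag((t+2)^w) · (uᵀ D) ∈ Ann_k(f)`, i.e. `uᵀ Ann_k(P_t)` is the
pull-back `B_t = diag((t+2)^w)⁻¹ A` of the subspace `A = Ann_k(f)` of degree-`k` forms; `uᵀ` and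
`(uᵀ)⁻¹` are coefficientwise continuous on degree-`k` forms (`tli_tendsto_coeffVec_linSubst`).  The
two Kuratowski clauses for `B_{ψ t} → in_w(A)`:

* `tli_exists_approx` — (Li) every `G ∈ in_w(A)` is a coefficientwise limit of `H_t ∈ B_{ψ t}`
  along any `ψ → ∞` (explicit approximants `c^ν diag(c^{-w}) E → π_ν E` for a lowest form `π_ν E`);
* `tli_limitMem` — (Ls) every subsequential limit of elements of `B_{φ t}` lies in `in_w(A)`:
  otherwise `in_w(A) ⊕ ℂG` would be a space of dimension `> dim A` all of whose elements are limits
  from the `dim A`-planes `B_{φ t}` (flatness `dim in_w(A) ≥ dim A`, `toricLimitIsInitial_flatness`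
  of the helper file), contradicting `finrank_le_of_kuratowski` (closedness of the Grassmannian).
-/

open MvPolynomial Filter
open scoped BigOperators Matrix Topology
open Literature.Computability.AlgebraicComplexity
open Summit.ValiantsHypothesis.ValiantsHypothesis.Theorems.BorderApolarityFixedWitnessObstructionQP
  (finrank_le_of_kuratowski mem_homogeneousSubmodule_of_tendsto)

namespace Summit.ValiantsHypothesis.ValiantsHypothesis.Theorems.BorderApolarityToricFixedPoints

set_option linter.dupNamespace false

section General

variable {σ : Type} [Fintype σ] [DecidableEq σ]

omit [Fintype σ] [DecidableEq σ] in
/-- Negating the weight negates the weight of every monomial. [folklore] -/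
theorem tli_weight_neg (w : σ → ℤ) (d : σ →₀ ℕ) :
    Finsupp.weight (fun i => -w i) d = -Finsupp.weight w d := by
  simp only [Finsupp.weight_apply, Finsupp.sum, smul_neg, Finset.sum_neg_distrib]

/-- Inverse torus substitution, the other way round: `diag(b^{-w}) · (diag(b^w) · p) = p`. [folklore] -/
theorem tli_linSubst_torus_neg_linSubst_torus (b : ℂ) (hb : b ≠ 0) (w : σ → ℤ)
    (p : MvPolynomial σ ℂ) :
    linSubst σ ℂ (Matrix.diagonal fun i => b ^ (-w i))
      (linSubst σ ℂ (Matrix.diagonal fun i => b ^ w i) p) = p := by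
  have h := tli_linSubst_torus_linSubst_torus_neg b hb (fun i => -w i) p
  simpa only [neg_neg] using h

/-- An invertible linear substitution preserves the dimension of subspaces under pull-back.
[folklore] -/
theorem tli_finrank_comap_linSubst (M : Matrix σ σ ℂ) (hM : IsUnit M.det)
    (A : Submodule ℂ (MvPolynomial σ ℂ)) :
    Module.finrank ℂ (A.comap (linSubst σ ℂ M).toLinearMap) = Module.finrank ℂ A := by
  let e : MvPolynomial σ ℂ ≃ₐ[ℂ] MvPolynomial σ ℂ :=
    AlgEquiv.ofAlgHom (linSubst σ ℂ M) (linSubst σ ℂ M⁻¹)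
      (by rw [← linSubst_mul, Matrix.mul_nonsing_inv M hM, linSubst_one])
      (by rw [← linSubst_mul, Matrix.nonsing_inv_mul M hM, linSubst_one])
  have he : (linSubst σ ℂ M).toLinearMap =
      (e.toLinearEquiv : MvPolynomial σ ℂ →ₗ[ℂ] MvPolynomial σ ℂ) := by
    ext x
    rfl
  rw [he, Submodule.comap_equiv_eq_map_symm, LinearEquiv.finrank_map_eq]

/-- **(Li) along a toric curve.**  For a subspace `A` of degree-`k` forms and `ψ → ∞`, every
element `G` of the initial span `in_w(A)` is a coefficientwise limit of degree-`k` forms `H t`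
with `diag((ψ t + 2)^w) · H t ∈ A`: for a generator `G = in(E) = π_ν E` take
`H t = c_t^ν diag(c_t^{-w}) · E`, whose `x^e`-coefficient `c_t^{ν - ⟨w,e⟩} E_e` tends to
`(π_ν E)_e`; sums and scalar multiples of approximants are approximants. [folklore] -/
theorem tli_exists_approx (w : σ → ℤ) (k : ℕ) (A : Submodule ℂ (MvPolynomial σ ℂ))
    (hA : A ≤ homogeneousSubmodule σ ℂ k) {ψ : ℕ → ℕ} (hψ : Tendsto ψ atTop atTop)
    {G : MvPolynomial σ ℂ}
    (hG : G ∈ Submodule.span ℂ {D : MvPolynomial σ ℂ | ∃ E ∈ A, ∃ ν : ℤ,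
      D = weightedHomogeneousComponent w ν E ∧
        ∀ ν' : ℤ, ν' < ν → weightedHomogeneousComponent w ν' E = 0}) :
    ∃ H : ℕ → MvPolynomial σ ℂ,
      (∀ t, (H t).IsHomogeneous k ∧
        linSubst σ ℂ (Matrix.diagonal fun i => ((ψ t : ℂ) + 2) ^ w i) (H t) ∈ A) ∧
      Tendsto (fun t => coeffVec (H t)) atTop (𝓝 (coeffVec G)) := by
  have hc0 : ∀ t, ((ψ t : ℂ) + 2) ≠ 0 := fun t => tli_natCast_add_two_ne_zero (ψ t)
  induction hG using Submodule.span_induction with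
  | mem x hx =>
    obtain ⟨E, hEA, ν, rfl, hlow⟩ := hx
    have hEhom : E.IsHomogeneous k := (mem_homogeneousSubmodule k E).1 (hA hEA)
    refine ⟨fun t => linSubst σ ℂ (Matrix.diagonal fun i => ((ψ t : ℂ) + 2) ^ (-w i))
      ((((ψ t : ℂ) + 2) ^ ν) • E), fun t => ⟨?_, ?_⟩, ?_⟩
    · refine linSubst_isHomogeneous _ ((mem_homogeneousSubmodule k _).1 ?_)
      exact (homogeneousSubmodule σ ℂ k).smul_mem _ (hA hEA)
    · rw [tli_linSubst_torus_linSubst_torus_neg _ (hc0 t) w]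
      exact A.smul_mem _ hEA
    · rw [tendsto_pi_nhds]
      intro d
      have key : ∀ t, coeffVec (linSubst σ ℂ (Matrix.diagonal fun i => ((ψ t : ℂ) + 2) ^ (-w i))
          ((((ψ t : ℂ) + 2) ^ ν) • E)) d = ((ψ t : ℂ) + 2) ^ (ν - Finsupp.weight w d) * coeff d E := by
        intro t
        rw [coeffVec_apply, tli_coeff_linSubst_torus _ (hc0 t) (fun i => -w i), coeff_smul, smul_eq_mul,
          ← mul_assoc, ← zpow_add₀ (hc0 t), tli_weight_neg, neg_add_eq_sub]
      simp_rw [key]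
      rw [coeffVec_apply, coeff_weightedHomogeneousComponent]
      rcases lt_trichotomy (Finsupp.weight w d) ν with hlt | heq | hgt
      · have h0 : coeff d E = 0 :=
          tli_coeff_eq_zero_of_weightedHomogeneousComponent_eq_zero w (hlow _ hlt) rfl
        simp only [h0, mul_zero, ite_self]
        exact tendsto_const_nhds
      · subst heq
        simp only [sub_self, zpow_zero, one_mul, if_true]
        exact tendsto_const_nhds
      · rw [if_neg (ne_of_gt hgt)]
        have h := (tli_tendsto_zpow_neg hψ (show ν - Finsupp.weight w d < 0 by omega)).mul_const
          (coeff d E)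
        rwa [zero_mul] at h
  | zero =>
    refine ⟨fun _ => 0, fun t => ⟨isHomogeneous_zero σ ℂ k, ?_⟩, tendsto_const_nhds⟩
    rw [map_zero]
    exact A.zero_mem
  | add x y _ _ hx hy =>
    obtain ⟨H₁, hH₁, hl₁⟩ := hx
    obtain ⟨H₂, hH₂, hl₂⟩ := hy
    refine ⟨fun t => H₁ t + H₂ t, fun t => ⟨(hH₁ t).1.add (hH₂ t).1, ?_⟩, ?_⟩
    · rw [map_add]
      exact A.add_mem (hH₁ t).2 (hH₂ t).2
    · have key : ∀ f g : MvPolynomial σ ℂ, coeffVec (f + g) = coeffVec f + coeffVec g := by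
        intro f g
        funext e
        simp only [coeffVec_apply, Pi.add_apply, coeff_add]
      simpa only [key] using hl₁.add hl₂
  | smul a x _ hx =>
    obtain ⟨H, hH, hl⟩ := hx
    refine ⟨fun t => a • H t, fun t => ⟨?_, ?_⟩, ?_⟩
    · exact (mem_homogeneousSubmodule k _).1
        ((homogeneousSubmodule σ ℂ k).smul_mem a ((mem_homogeneousSubmodule k _).2 (hH t).1))
    · rw [map_smul]
      exact A.smul_mem a (hH t).2
    · have key : ∀ f : MvPolynomial σ ℂ, coeffVec (a • f) = a • coeffVec f := by
        intro f
        funext e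
        simp only [coeffVec_apply, Pi.smul_apply, coeff_smul]
      simpa only [key] using hl.const_smul a


/-- **(Ls) along a toric curve.**  For a subspace `A` of degree-`k` forms, a strictly monotone
`φ`, and forms `Gs t` with `diag((φ t + 2)^w) · Gs t ∈ A` converging coefficientwise to `G`, the
limit `G` lies in the initial span `in_w(A)`.  Otherwise `M' = in_w(A) ⊕ ℂ G` is a space of degree-`k`
forms of dimension `> dim in_w(A) ≥ dim A` (flatness, `toricLimitIsInitial_flatness`) every
element of which is a limit of elements of the `dim A`-planes `B_{φ t} = diag((φ t + 2)^w)⁻¹ A`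
((Li), `tli_exists_approx`, plus the given sequence), contradicting `finrank_le_of_kuratowski`
(in the coordinates of the degree-`k` monomials). [folklore] -/
theorem tli_limitMem (w : σ → ℤ) (k : ℕ) (A : Submodule ℂ (MvPolynomial σ ℂ))
    (hA : A ≤ homogeneousSubmodule σ ℂ k) {φ : ℕ → ℕ} (hφ : StrictMono φ)
    {G : MvPolynomial σ ℂ} {Gs : ℕ → MvPolynomial σ ℂ}
    (hGs : ∀ t, linSubst σ ℂ (Matrix.diagonal fun i => ((φ t : ℂ) + 2) ^ w i) (Gs t) ∈ A)
    (hlim : Tendsto (fun t => coeffVec (Gs t)) atTop (𝓝 (coeffVec G))) :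
    G ∈ Submodule.span ℂ {D : MvPolynomial σ ℂ | ∃ E ∈ A, ∃ ν : ℤ,
      D = weightedHomogeneousComponent w ν E ∧
        ∀ ν' : ℤ, ν' < ν → weightedHomogeneousComponent w ν' E = 0} := by
  classical
  haveI : Module.Finite ℂ (homogeneousSubmodule σ ℂ k) :=
    Module.Finite.iff_fg.2 (homogeneousSubmodule_fg σ ℂ k)
  haveI : FiniteDimensional ℂ A := Submodule.finiteDimensional_of_le hA
  have hc0 : ∀ s : ℕ, ((s : ℂ) + 2) ≠ 0 := tli_natCast_add_two_ne_zero
  -- the moving planes `B s = diag((s+2)^w)⁻¹ A`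
  set B : ℕ → Submodule ℂ (MvPolynomial σ ℂ) := fun s =>
    A.comap (linSubst σ ℂ (Matrix.diagonal fun i => ((s : ℂ) + 2) ^ w i)).toLinearMap with hB
  have hBmem : ∀ (s : ℕ) (H : MvPolynomial σ ℂ),
      H ∈ B s ↔ linSubst σ ℂ (Matrix.diagonal fun i => ((s : ℂ) + 2) ^ w i) H ∈ A :=
    fun s H => Iff.rfl
  have hBle : ∀ s, B s ≤ homogeneousSubmodule σ ℂ k := by
    intro s H hH
    rw [← tli_linSubst_torus_neg_linSubst_torus _ (hc0 s) w H]
    exact linSubst_mem_homogeneousSubmodule _ (hA ((hBmem s H).1 hH))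
  have hBfin : ∀ s, Module.finrank ℂ (B s) = Module.finrank ℂ A := fun s =>
    tli_finrank_comap_linSubst _ (tli_isUnit_det_diagonal_zpow _ (hc0 s) w) A
  -- the initial span and the candidate bigger space
  set In := Submodule.span ℂ {D : MvPolynomial σ ℂ | ∃ E ∈ A, ∃ ν : ℤ,
    D = weightedHomogeneousComponent w ν E ∧
      ∀ ν' : ℤ, ν' < ν → weightedHomogeneousComponent w ν' E = 0} with hIn
  have hIn_le : In ≤ homogeneousSubmodule σ ℂ k := by
    refine Submodule.span_le.2 ?_
    rintro _ ⟨E, hE, ν, rfl, -⟩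
    exact (mem_homogeneousSubmodule k _).2 (tli_isHomogeneous_weightedHomogeneousComponent w ν
      ((mem_homogeneousSubmodule k E).1 (hA hE)))
  haveI : FiniteDimensional ℂ In := Submodule.finiteDimensional_of_le hIn_le
  have hGs_hom : ∀ t, Gs t ∈ homogeneousSubmodule σ ℂ k := fun t => hBle (φ t) (hGs t)
  have hG_hom : G ∈ homogeneousSubmodule σ ℂ k := mem_homogeneousSubmodule_of_tendsto k hGs_hom hlim
  by_contra hGIn
  set M' : Submodule ℂ (MvPolynomial σ ℂ) := In ⊔ Submodule.span ℂ {G} with hM'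
  have hM'le : M' ≤ homogeneousSubmodule σ ℂ k :=
    sup_le hIn_le ((Submodule.span_singleton_le_iff_mem _ _).2 hG_hom)
  haveI : FiniteDimensional ℂ M' := Submodule.finiteDimensional_of_le hM'le
  have hlt : In < M' := by
    refine lt_of_le_of_ne le_sup_left fun h => hGIn ?_
    rw [h]
    exact Submodule.mem_sup_right (Submodule.mem_span_singleton_self G)
  have h1 : Module.finrank ℂ In < Module.finrank ℂ M' := Submodule.finrank_lt_finrank_of_lt hlt
  have hflat : Module.finrank ℂ A ≤ Module.finrank ℂ In := toricLimitIsInitial_flatness w k A hA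
  -- (Li) for `M'` along `φ`
  have hLi : ∀ G' ∈ M', ∃ H : ℕ → MvPolynomial σ ℂ, (∀ t, H t ∈ B (φ t)) ∧
      Tendsto (fun t => coeffVec (H t)) atTop (𝓝 (coeffVec G')) := by
    intro G' hG'
    obtain ⟨y, hy, z, hz, rfl⟩ := Submodule.mem_sup.1 hG'
    obtain ⟨a, rfl⟩ := Submodule.mem_span_singleton.1 hz
    obtain ⟨H₁, hH₁, hl₁⟩ := tli_exists_approx w k A hA hφ.tendsto_atTop hy
    refine ⟨fun t => H₁ t + a • Gs t, fun t => ?_, ?_⟩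
    · exact (B (φ t)).add_mem (hH₁ t).2 ((B (φ t)).smul_mem a (hGs t))
    · have key : ∀ f g : MvPolynomial σ ℂ, coeffVec (f + a • g) = coeffVec f + a • coeffVec g := by
        intro f g
        funext e
        simp only [coeffVec_apply, Pi.add_apply, Pi.smul_apply, coeff_add, coeff_smul]
      simpa only [key] using hl₁.add (hlim.const_smul a)
  -- transport to the coordinates of the degree-`k` monomials and count dimensions
  haveI : Fintype {e : σ →₀ ℕ // e.degree = k} :=
    Fintype.subtype ((Finset.univ : Finset σ).finsuppAntidiag k) fun e => by
      simp [Finset.mem_finsuppAntidiag, Finsupp.degree_eq_sum]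
  obtain ⟨π, hπ⟩ : ∃ π : MvPolynomial σ ℂ →ₗ[ℂ] ({e : σ →₀ ℕ // e.degree = k} → ℂ),
      ∀ f e, π f e = coeff e.1 f :=
    ⟨LinearMap.pi fun e => lcoeff ℂ e.1, fun _ _ => rfl⟩
  have hinj : ∀ f ∈ homogeneousSubmodule σ ℂ k, π f = 0 → f = 0 := by
    intro f hf h0
    ext e
    rw [coeff_zero]
    by_cases he : e.degree = k
    · have h := congrFun h0 ⟨e, he⟩
      rwa [hπ] at h
    · exact ((mem_homogeneousSubmodule k f).1 hf).coeff_eq_zero he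
  have hfin : ∀ p : Submodule ℂ (MvPolynomial σ ℂ), p ≤ homogeneousSubmodule σ ℂ k →
      Module.finrank ℂ (p.map π) = Module.finrank ℂ p := by
    intro p hp
    rw [← LinearMap.range_domRestrict]
    apply LinearMap.finrank_range_of_inj
    intro x y hxy
    apply Subtype.ext
    have h := hinj (x.1 - y.1) (Submodule.sub_mem _ (hp x.2) (hp y.2))
      (by rw [map_sub, sub_eq_zero]; exact hxy)
    exact sub_eq_zero.1 h
  have h2 : Module.finrank ℂ (M'.map π) ≤ Module.finrank ℂ A := by
    refine finrank_le_of_kuratowski (Module.finrank ℂ A) (fun t => (B (φ t)).map π) (M'.map π)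
      (fun t => (hfin _ (hBle _)).trans (hBfin _)) ?_
    intro x hx
    obtain ⟨G', hG', rfl⟩ := Submodule.mem_map.1 hx
    obtain ⟨H, hH, hl⟩ := hLi G' hG'
    refine ⟨fun t => π (H t), fun t => Submodule.mem_map_of_mem (hH t), ?_⟩
    refine tendsto_pi_nhds.2 fun e => ?_
    have h3 : Tendsto (fun t => coeffVec (H t) e.1) atTop (𝓝 (coeffVec G' e.1)) :=
      (continuous_apply e.1).continuousAt.tendsto.comp hl
    simpa only [hπ, coeffVec_apply] using h3
  rw [hfin M' hM'le] at h2
  omega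

omit [Fintype σ] [DecidableEq σ] in
/-- `Ann_k(f)` is (the carrier of) a subspace of the degree-`k` forms (bilinearity of `⌟`).
[folklore] -/
theorem tli_exists_annSubmodule (k : ℕ) (f : MvPolynomial σ ℂ) :
    ∃ A : Submodule ℂ (MvPolynomial σ ℂ), (∀ E, E ∈ A ↔ E ∈ annihilatorOfDegree f k) ∧
      A ≤ homogeneousSubmodule σ ℂ k := by
  refine ⟨{ carrier := annihilatorOfDegree f k
            add_mem' := fun {D E} hD hE => ⟨hD.1.add hE.1, ?_⟩
            zero_mem' := zero_mem_annihilatorOfDegree f k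
            smul_mem' := fun c D hD => ⟨?_, ?_⟩ }, fun E => Iff.rfl,
    fun E hE => (mem_homogeneousSubmodule k E).2 hE.1⟩
  · rw [apolarAction_add_left, hD.2, hE.2, add_zero]
  · exact (mem_homogeneousSubmodule k _).1
      ((homogeneousSubmodule σ ℂ k).smul_mem c ((mem_homogeneousSubmodule k D).2 hD.1))
  · rw [apolarAction_smul_left, hD.2, smul_zero]

/-- **Toric Kuratowski limits, general form.**  For an invertible matrix `U`, an integer weight `w`
and any polynomial `f`, along `P_t = U · diag((t+2)^w) · f` the degree-wise Kuratowski limit of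
the annihilators is `{D : Uᵀ D ∈ in_w(Ann_k f)}` (all degrees `k ≤ d`). [folklore] -/
theorem tli_isBorderApolarLimit_toric (d : ℕ) (U : Matrix σ σ ℂ) (hU : IsUnit U.det) (w : σ → ℤ)
    (f : MvPolynomial σ ℂ) :
    IsBorderApolarLimit d
      (fun t : ℕ => linSubst σ ℂ U
        (linSubst σ ℂ (Matrix.diagonal fun i : σ => ((t : ℂ) + 2) ^ (w i)) f))
      (fun k => {D | linSubst σ ℂ Uᵀ D ∈
        Submodule.span ℂ {D' : MvPolynomial σ ℂ | ∃ E ∈ annihilatorOfDegree f k, ∃ ν : ℤ,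
          D' = weightedHomogeneousComponent w ν E ∧
            ∀ ν' : ℤ, ν' < ν → weightedHomogeneousComponent w ν' E = 0}}) := by
  have hc0 : ∀ s : ℕ, ((s : ℂ) + 2) ≠ 0 := tli_natCast_add_two_ne_zero
  have hUT : IsUnit Uᵀ.det := Matrix.isUnit_det_transpose U hU
  -- transport of annihilators along `P_s = (U · diag) · f`
  have hP : ∀ s : ℕ, linSubst σ ℂ U (linSubst σ ℂ (Matrix.diagonal fun i : σ => ((s : ℂ) + 2) ^ (w i)) f) =
      linSubst σ ℂ (U * Matrix.diagonal fun i : σ => ((s : ℂ) + 2) ^ (w i)) f := by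
    intro s
    rw [linSubst_mul]
    rfl
  have hker : ∀ (s : ℕ) (D : MvPolynomial σ ℂ),
      apolarAction D (linSubst σ ℂ U
        (linSubst σ ℂ (Matrix.diagonal fun i : σ => ((s : ℂ) + 2) ^ (w i)) f)) = 0 ↔
      apolarAction (linSubst σ ℂ (Matrix.diagonal fun i : σ => ((s : ℂ) + 2) ^ (w i))
        (linSubst σ ℂ Uᵀ D)) f = 0 := by
    intro s D
    have hunit : IsUnit (U * Matrix.diagonal fun i : σ => ((s : ℂ) + 2) ^ (w i)).det := by
      rw [Matrix.det_mul]
      exact hU.mul (tli_isUnit_det_diagonal_zpow _ (hc0 s) w)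
    rw [hP s, apolarAction_linSubst_eq_zero_iff _ hunit, Matrix.transpose_mul,
      Matrix.diagonal_transpose, linSubst_mul, AlgHom.comp_apply]
  have hinv : ∀ p : MvPolynomial σ ℂ, linSubst σ ℂ Uᵀ (linSubst σ ℂ Uᵀ⁻¹ p) = p := by
    intro p
    rw [← AlgHom.comp_apply, ← linSubst_mul, Matrix.mul_nonsing_inv _ hUT, linSubst_one,
      AlgHom.id_apply]
  have hinv' : ∀ p : MvPolynomial σ ℂ, linSubst σ ℂ Uᵀ⁻¹ (linSubst σ ℂ Uᵀ p) = p := by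
    intro p
    rw [← AlgHom.comp_apply, ← linSubst_mul, Matrix.nonsing_inv_mul _ hUT, linSubst_one,
      AlgHom.id_apply]
  -- the annihilator subspaces and the rewriting of the initial span
  have hAk : ∀ k : ℕ, ∃ A : Submodule ℂ (MvPolynomial σ ℂ), A ≤ homogeneousSubmodule σ ℂ k ∧
      (∀ E, E ∈ A ↔ E ∈ annihilatorOfDegree f k) ∧
      {D' : MvPolynomial σ ℂ | ∃ E ∈ annihilatorOfDegree f k, ∃ ν : ℤ,
          D' = weightedHomogeneousComponent w ν E ∧
            ∀ ν' : ℤ, ν' < ν → weightedHomogeneousComponent w ν' E = 0} =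
        {D' : MvPolynomial σ ℂ | ∃ E ∈ A, ∃ ν : ℤ,
          D' = weightedHomogeneousComponent w ν E ∧
            ∀ ν' : ℤ, ν' < ν → weightedHomogeneousComponent w ν' E = 0} := by
    intro k
    obtain ⟨A, hmemA, hAle⟩ := tli_exists_annSubmodule k f
    refine ⟨A, hAle, hmemA, ?_⟩
    ext D'
    simp only [Set.mem_setOf_eq, hmemA]
  refine ⟨fun k _ D hD => ?_, fun k _ D φ Ds hφ hDs hlim => ?_⟩
  · -- (Li): approximate `Uᵀ D ∈ in_w(Ann_k f)` inside `B_t`, then apply `(Uᵀ)⁻¹`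
    obtain ⟨A, hAle, hmemA, hset⟩ := hAk k
    have hG : linSubst σ ℂ Uᵀ D ∈ Submodule.span ℂ {D' : MvPolynomial σ ℂ | ∃ E ∈ A, ∃ ν : ℤ,
        D' = weightedHomogeneousComponent w ν E ∧
          ∀ ν' : ℤ, ν' < ν → weightedHomogeneousComponent w ν' E = 0} := by
      rw [← hset]
      exact hD
    have hGhom : (linSubst σ ℂ Uᵀ D).IsHomogeneous k := by
      refine (mem_homogeneousSubmodule k _).1 (Submodule.span_le.2 ?_ hG)
      rintro _ ⟨E, hE, ν, rfl, -⟩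
      exact (mem_homogeneousSubmodule k _).2 (tli_isHomogeneous_weightedHomogeneousComponent w ν
        ((mem_homogeneousSubmodule k E).1 (hAle hE)))
    obtain ⟨H, hH, hl⟩ := tli_exists_approx w k A hAle (ψ := fun t => t) tendsto_id hG
    refine ⟨fun t => linSubst σ ℂ Uᵀ⁻¹ (H t), fun t => ⟨linSubst_isHomogeneous _ (hH t).1, ?_⟩, ?_⟩
    · rw [hker t, hinv]
      exact ((hmemA _).1 (hH t).2).2
    · have h := tli_tendsto_coeffVec_linSubst Uᵀ⁻¹ (fun t => (hH t).1) hGhom hl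
      rwa [hinv'] at h
  · -- (Ls): transport the sequence by `Uᵀ` and apply the closedness lemma
    obtain ⟨A, hAle, hmemA, hset⟩ := hAk k
    have hDhom : D.IsHomogeneous k :=
      (mem_homogeneousSubmodule k D).1 (mem_homogeneousSubmodule_of_tendsto k
        (fun t => (mem_homogeneousSubmodule k _).2 (hDs t).1) hlim)
    have hGs : ∀ t, linSubst σ ℂ (Matrix.diagonal fun i : σ => ((φ t : ℂ) + 2) ^ (w i))
        (linSubst σ ℂ Uᵀ (Ds t)) ∈ A := by
      intro t
      refine (hmemA _).2 ⟨linSubst_isHomogeneous _ (linSubst_isHomogeneous _ (hDs t).1), ?_⟩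
      exact (hker (φ t) (Ds t)).1 (hDs t).2
    have hlimG := tli_tendsto_coeffVec_linSubst Uᵀ (fun t => (hDs t).1) hDhom hlim
    have hmem : linSubst σ ℂ Uᵀ D ∈ Submodule.span ℂ {D' : MvPolynomial σ ℂ |
        ∃ E ∈ annihilatorOfDegree f k, ∃ ν : ℤ, D' = weightedHomogeneousComponent w ν E ∧
          ∀ ν' : ℤ, ν' < ν → weightedHomogeneousComponent w ν' E = 0} := by
      rw [hset]
      exact tli_limitMem w k A hAle hφ hGs hlimG
    exact hmem

end General

/-- S1 — TORIC KURATOWSKI LIMIT = TRANSLATED LOWEST-WEIGHT INITIAL SPAN (true, M).  Along the toric curve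
`t ↦ u·diag((t+2)^w)·f` the degree-wise Kuratowski limit of the annihilators exists and equals
`{D : uᵀ·D ∈ in_w(Ann_k f)}`: `Ann(A·f) = {D : Aᵀ D ∈ Ann f}` (`apolarAction_linSubst_eq_zero_iff`), so
`Ann_k(diag(c_t)·f) = {Σ a_e (t+2)^{−⟨w,e⟩} ∂^e : Σ a_e ∂^e ∈ Ann_k f}`; `lim inf ⊇` lowest forms; the
dimension count `dim in_w A ≥ dim A` with closedness of the Grassmannian controls every subsequential
limit.  Stated for an arbitrary polynomial `f`. [folklore] -/
theorem stub_toricLimitIsInitial :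
    ∀ (m : ℕ) (u : Matrix.GeneralLinearGroup (Fin m × Fin m) ℂ) (w : Fin m × Fin m → ℤ)
      (f : MvPolynomial (Fin m × Fin m) ℂ),
      IsBorderApolarLimit m
        (fun t : ℕ => linSubst (Fin m × Fin m) ℂ (u : Matrix (Fin m × Fin m) (Fin m × Fin m) ℂ)
          (linSubst (Fin m × Fin m) ℂ (Matrix.diagonal fun i : Fin m × Fin m => ((t : ℂ) + 2) ^ (w i)) f))
        (fun k => {D | linSubst (Fin m × Fin m) ℂ (u : Matrix (Fin m × Fin m) (Fin m × Fin m) ℂ)ᵀ D ∈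
          Submodule.span ℂ {D' : MvPolynomial (Fin m × Fin m) ℂ | ∃ E ∈ annihilatorOfDegree f k, ∃ ν : ℤ,
            D' = weightedHomogeneousComponent w ν E ∧
              ∀ ν' : ℤ, ν' < ν → weightedHomogeneousComponent w ν' E = 0}}) := by
  intro m u w f
  exact tli_isBorderApolarLimit_toric m (u : Matrix (Fin m × Fin m) (Fin m × Fin m) ℂ)
    ((Matrix.isUnit_iff_isUnit_det _).1 u.isUnit) w f

end Summit.ValiantsHypothesis.ValiantsHypothesis.Theorems.BorderApolarityToricFixedPoints
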